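import Mathlib
import Literature.Probability.Percolation.ProdBernoulliRusso
import Literature.Probability.LatticeModels.ProdBernoulliIndependence
import Literature.Probability.Percolation.FlipResponse
import HarnessLib

/-!
# The annealed flip–Russo formula for an environment of independent bits

Helper file for the crux `QuadrupoleSelectionRule` (stmt-CriticalPhenomena-7029, informal) of route
`CardyFlipRusso` (sub-problem `CardyFormulaZ2`), line `Sketch`, stub W1 (`stub_annealed_flipRusso`):
the annealed Russo / flip formula for a leg whose random environment is a product of independent
bits — the route's leg L5 of `SquareFromVoronoiHub` ("independent diagonals": every face `k` of
the rotated square grid carries one of its two diagonals, independently, `P(ℤ²-diagonal) = t`).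

The environment is `τ ⊆ κ`, the set of faces carrying the "BD" diagonal, with law
`prodBernoulli (fun _ ↦ t)`; the graph is `Γ τ`, and switching face `k` is the diagonal flip
`flipGraph` at the quadrilateral `(A k, B k, C k, D k)`. The colours are independent of the
environment (`sitePercolation V p`), so the annealed probability of a graph-dependent event `U` is
`E_t[P_p(U(Γ τ))]`, and in a bounded domain only the finitely many faces `K` matter. The formula
(`hasDerivWithinAt_annealed_flipLeg`):

  `d/dt E_t[P_p(U(Γ τ))] = Σ_{k ∈ K} E_t[Δ_k]`,
  `Δ_k(τ) = flipResponse (Γ (τ \ {k})) (A k) (B k) (C k) (D k) U p`,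

the discrete derivative in the bit `k` being the flip response of face `k` of the graph with face
`k` in state "AC". It is the case `g τ = P_p(U(Γ τ))` of the Margulis–Russo formula for FUNCTIONS
of finitely many independent bits along the diagonal path `t ↦ (t, …, t)`
(`hasDerivWithinAt_integral_prodBernoulli_const`):
`d/dt E_t[g] = Σ_{k ∈ K} E_t[g(τ ∪ {k}) − g(τ \ {k})]`, proved — as the tree's
`hasDerivAt_prodBernoulli_real` (`Literature/Probability/Percolation/ProdBernoulliRusso.lean`) and
`russoMixture_hasDerivWithinAt` (crux `LoopLimitZ2EqT`, stub S5a), whose proofs are adapted here —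
by the cylinder expansion `E_q[g] = Σ_{S ⊆ K} g(S) ∏_{i ∈ K} w_i(S, q)` (a multi-affine polynomial
in the densities), the product rule, and the pairing `T ↔ T ∪ {e}` of the subsets of `K`.
No monotonicity is involved.
-/

noncomputable section

open MeasureTheory Set Filter
open scoped Topology BigOperators

namespace Summit.CriticalPhenomena.CardyFormulaZ2.Theorems

open Literature.Probability.LatticeModels Literature.Probability.Percolation

namespace AnnealedRusso

variable {κ : Type*}

/-! ### Functions of finitely many bits: cylinder expansion of the expectation -/

/-- A function of `τ` reading only the bits in the finite set `K` is the finite combination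
`g = Σ_{S ⊆ K} g(S) · 1_{[S]_K}` of the indicator functions of the `K`-cylinders. [folklore] -/
theorem eq_sum_indicator_localCylinder (K : Finset κ) (g : Set κ → ℝ)
    (hg : ∀ τ : Set κ, g τ = g (τ ∩ ↑K)) (τ : Set κ) :
    g τ = ∑ S ∈ K.powerset, (localCylinder (↑K : Set κ) ↑S).indicator (fun _ ↦ g ↑S) τ := by
  classical
  set S₀ : Finset κ := K.filter (· ∈ τ) with hS₀
  have hS₀K : S₀ ∈ K.powerset := Finset.mem_powerset.2 (Finset.filter_subset _ _)
  have hτS₀ : τ ∈ localCylinder (↑K : Set κ) ↑S₀ := by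
    intro i hi
    simp [hS₀, Finset.mem_coe.1 hi]
  have hcoe : (↑S₀ : Set κ) = τ ∩ ↑K := by
    ext i
    simp [hS₀, and_comm]
  rw [Finset.sum_eq_single_of_mem S₀ hS₀K fun S hS hne ↦ Set.indicator_of_notMem
    (fun hτS ↦ Set.disjoint_left.1 (Russo.disjoint_localCylinder (Finset.mem_powerset.1 hS)
      (Finset.mem_powerset.1 hS₀K) hne) hτS hτS₀) _]
  rw [Set.indicator_of_mem hτS₀, hcoe]
  exact hg τ

/-- **Cylinder expansion of the expectation.** For `g` reading only the bits in `K`,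
`E_q[g] = Σ_{S ⊆ K} g(S) ∏_{i ∈ K} w_i(S, q)` with `w_i(S, q) = q_i` for `i ∈ S` and `1 - q_i`
otherwise — a multi-affine polynomial in the densities `q_i`, `i ∈ K`. [folklore] -/
theorem integral_prodBernoulli_eq_sum_powerset [DecidableEq κ] (K : Finset κ) (g : Set κ → ℝ)
    (hg : ∀ τ : Set κ, g τ = g (τ ∩ ↑K)) (q : κ → unitInterval) :
    ∫ τ, g τ ∂(prodBernoulli q) =
      ∑ S ∈ K.powerset, g ↑S * ∏ i ∈ K, (if i ∈ S then (q i : ℝ) else 1 - (q i : ℝ)) := by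
  have hmeas : ∀ S : Finset κ, MeasurableSet (localCylinder (↑K : Set κ) (↑S : Set κ)) :=
    fun S ↦ measurableSet_localCylinder K.finite_toSet.countable _
  have h1 : ∫ τ, g τ ∂(prodBernoulli q) = ∫ τ, (∑ S ∈ K.powerset,
      (localCylinder (↑K : Set κ) ↑S).indicator (fun _ ↦ g ↑S) τ) ∂(prodBernoulli q) :=
    integral_congr_ae (Eventually.of_forall fun τ ↦ eq_sum_indicator_localCylinder K g hg τ)
  rw [h1, integral_finsetSum K.powerset fun S _ ↦ (integrable_const (g ↑S)).indicator (hmeas S)]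
  refine Finset.sum_congr rfl fun S _ ↦ ?_
  rw [integral_indicator_const _ (hmeas S), smul_eq_mul,
    RussoPath.prodBernoulli_real_localCylinder_eq q K S]
  exact mul_comm _ _

/-- Pairing `T ↔ insert e T` of the subsets of `K` along a fixed `e ∈ K`. [folklore] -/
theorem sum_powerset_eq_sum_powerset_erase_add [DecidableEq κ] {K : Finset κ} {e : κ}
    (he : e ∈ K) (φ : Finset κ → ℝ) :
    ∑ S ∈ K.powerset, φ S = ∑ T ∈ (K.erase e).powerset, (φ T + φ (insert e T)) := by
  conv_lhs => rw [← Finset.insert_erase he]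
  rw [Finset.sum_powerset_insert (Finset.notMem_erase e K), Finset.sum_add_distrib]

end AnnealedRusso

open AnnealedRusso

/-! ### The Margulis–Russo formula for functions, along the diagonal path -/

/-- **Russo's formula for a function of finitely many independent bits of common density.**
Let `g : Set κ → ℝ` read only the bits in the finite set `K`, and give every bit the density
`t ∈ [0, 1]` (the path `b ↦ (b, …, b)`, clamped to `[0, 1]` by `Set.projIcc`). Then
`b ↦ E_b[g]` has, at `t` within `[0, 1]`, the derivative
`Σ_{k ∈ K} E_t[g(τ ∪ {k}) − g(τ \ {k})]` — the sum over the bits of the expected discrete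
derivatives. The cylinder expansion of `E_b[g]` is a multi-affine polynomial in the densities, the
product rule differentiates it, and the `k`-th partial derivative is identified with the expected
bracket by pairing the subsets `T`, `T ∪ {k}` of `K`. No monotonicity of `g`. [folklore] -/
theorem hasDerivWithinAt_integral_prodBernoulli_const {κ : Type*} [DecidableEq κ] (K : Finset κ)
    (g : Set κ → ℝ) (hg : ∀ τ : Set κ, g τ = g (τ ∩ ↑K)) {t : ℝ} (ht : t ∈ Set.Icc (0 : ℝ) 1) :
    HasDerivWithinAt
      (fun b : ℝ => ∫ τ, g τ ∂(prodBernoulli fun _ : κ => Set.projIcc 0 1 zero_le_one b))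
      (∑ k ∈ K, ∫ τ, (g (insert k τ) - g (τ \ {k}))
          ∂(prodBernoulli fun _ : κ => Set.projIcc 0 1 zero_le_one t))
      (Set.Icc 0 1) t := by
  -- the diagonal path, clamped to `[0,1]`, and its derivative `1` within `[0,1]`
  set π : ℝ → ℝ := fun b ↦ ((Set.projIcc (0 : ℝ) 1 zero_le_one b : unitInterval) : ℝ) with hπ
  have hπd : HasDerivWithinAt π 1 (Icc 0 1) t := by
    refine (hasDerivWithinAt_id t (Icc (0 : ℝ) 1)).congr_of_mem (fun b hb ↦ ?_) ht
    simp [hπ, Set.projIcc_of_mem zero_le_one hb]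
  -- the cylinder weights and their derivatives
  set w : Finset κ → κ → ℝ → ℝ := fun S i b ↦ if i ∈ S then π b else 1 - π b with hw
  set dw : Finset κ → κ → ℝ := fun S i ↦ if i ∈ S then (1 : ℝ) else -1 with hdw
  have hwd : ∀ (S : Finset κ) (i : κ), HasDerivWithinAt (w S i) (dw S i) (Icc 0 1) t := by
    intro S i
    by_cases hiS : i ∈ S
    · have h1 : w S i = π := by funext b; simp [hw, hiS]
      have h2 : dw S i = 1 := by simp [hdw, hiS]
      rw [h1, h2]; exact hπd
    · have h1 : w S i = fun b ↦ 1 - π b := by funext b; simp [hw, hiS]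
      have h2 : dw S i = -1 := by simp [hdw, hiS]
      rw [h1, h2]; exact hπd.const_sub 1
  -- `E_b[g]` is the cylinder polynomial
  have hrepr : (fun b : ℝ ↦ ∫ τ, g τ ∂(prodBernoulli fun _ : κ ↦ Set.projIcc (0 : ℝ) 1
      zero_le_one b)) = fun b ↦ ∑ S ∈ K.powerset, g ↑S * ∏ i ∈ K, w S i b := by
    funext b
    rw [integral_prodBernoulli_eq_sum_powerset K g hg]
  rw [hrepr]
  -- differentiate term by term (product rule)
  have hderiv : HasDerivWithinAt (fun b ↦ ∑ S ∈ K.powerset, g ↑S * ∏ i ∈ K, w S i b)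
      (∑ S ∈ K.powerset, g ↑S * ∑ e ∈ K, (∏ j ∈ K.erase e, w S j t) * dw S e) (Icc 0 1) t := by
    refine HasDerivWithinAt.fun_sum fun S _ ↦ ?_
    have := (HasDerivWithinAt.fun_finsetProd (u := K) (x := t) (s := Icc (0 : ℝ) 1)
      fun i _ ↦ hwd S i).const_mul (g ↑S)
    simpa [smul_eq_mul] using this
  refine hderiv.congr_deriv ?_
  -- the right-hand side: the brackets `g (τ ∪ {k}) - g (τ \ {k})` read only the bits in `K`
  have hdet : ∀ (k : κ) (τ : Set κ),
      g (insert k τ) - g (τ \ {k}) = g (insert k (τ ∩ ↑K)) - g ((τ ∩ ↑K) \ {k}) := by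
    intro k τ
    have h1 : insert k τ ∩ (↑K : Set κ) = insert k (τ ∩ ↑K) ∩ ↑K := by
      ext i
      simp only [Set.mem_inter_iff, Set.mem_insert_iff]
      tauto
    have h2 : (τ \ {k}) ∩ (↑K : Set κ) = ((τ ∩ ↑K) \ {k}) ∩ ↑K := by
      ext i
      simp only [Set.mem_inter_iff, Set.mem_sdiff, Set.mem_singleton_iff]
      tauto
    rw [hg (insert k τ), hg (insert k (τ ∩ ↑K)), hg (τ \ {k}), hg ((τ ∩ ↑K) \ {k}), h1, h2]
  have hR : ∀ k : κ, ∫ τ, (g (insert k τ) - g (τ \ {k}))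
      ∂(prodBernoulli fun _ : κ ↦ Set.projIcc (0 : ℝ) 1 zero_le_one t) =
      ∑ S ∈ K.powerset, (g (insert k ↑S) - g (↑S \ {k})) * ∏ i ∈ K, w S i t := by
    intro k
    rw [integral_prodBernoulli_eq_sum_powerset K (fun τ ↦ g (insert k τ) - g (τ \ {k})) (hdet k)]
  rw [Finset.sum_congr rfl fun k (_ : k ∈ K) ↦ hR k]
  -- exchange the sums on the left
  simp_rw [Finset.mul_sum]
  rw [Finset.sum_comm (s := K.powerset) (t := K)]
  refine Finset.sum_congr rfl fun e he ↦ ?_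
  -- the `e`-th term: pair `T ↔ insert e T`
  rw [sum_powerset_eq_sum_powerset_erase_add he, sum_powerset_eq_sum_powerset_erase_add he]
  refine Finset.sum_congr rfl fun T hT ↦ ?_
  have heT : e ∉ T := fun h ↦ by simpa using Finset.mem_powerset.1 hT h
  have heT' : e ∉ (↑T : Set κ) := by simpa using heT
  -- off `e` the weights of `T` and `insert e T` agree
  have hwi : ∏ j ∈ K.erase e, w (insert e T) j t = ∏ j ∈ K.erase e, w T j t := by
    refine Finset.prod_congr rfl fun j hj ↦ ?_
    have hje : j ≠ e := Finset.ne_of_mem_erase hj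
    simp [hw, Finset.mem_insert, hje]
  rw [← Finset.mul_prod_erase K (fun i ↦ w T i t) he,
    ← Finset.mul_prod_erase K (fun i ↦ w (insert e T) i t) he, hwi]
  have hwe : w T e t = 1 - π t := by simp [hw, heT]
  have hwe' : w (insert e T) e t = π t := by simp [hw]
  have hde : dw T e = -1 := by simp [hdw, heT]
  have hde' : dw (insert e T) e = 1 := by simp [hdw]
  rw [hwe, hwe', hde, hde', Finset.coe_insert, Set.insert_idem, Set.sdiff_singleton_eq_self heT',
    Set.insert_sdiff_self_of_notMem heT']
  ring

/-! ### The annealed flip–Russo formula (leg L5: independent diagonals) -/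

/-- **Annealed flip–Russo formula for a product-of-bits environment.** Let the graph `Γ τ` depend
on the set `τ ⊆ κ` of switched faces only through the finitely many faces in `K`, and let
switching face `k ∈ K` be the diagonal flip of the quadrilateral `(A k, B k, C k, D k)`:
`Γ (τ ∪ {k}) = flipGraph (Γ (τ \ {k})) (A k) (B k) (C k) (D k)`. If the faces are switched
independently with probability `t` (law `prodBernoulli (fun _ ↦ t)`, the colours being an
independent Bernoulli site percolation of density `p`), then the annealed probability of a
graph-dependent event `U` satisfies
`d/dt E_t[P_p(U(Γ τ))] = Σ_{k ∈ K} E_t[flipResponse (Γ (τ \ {k})) (A k) (B k) (C k) (D k) U p]`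
(derivative at `t` within `[0, 1]`): the sum over the faces of the expected flip responses.
[folklore] -/
theorem hasDerivWithinAt_annealed_flipLeg {κ V : Type*} [DecidableEq κ] (K : Finset κ)
    (Γ : Set κ → SimpleGraph V) (hΓ : ∀ τ : Set κ, Γ τ = Γ (τ ∩ ↑K)) (A B C D : κ → V)
    (hflip : ∀ (τ : Set κ) (k : κ), k ∈ K →
      Γ (insert k τ) = flipGraph (Γ (τ \ {k})) (A k) (B k) (C k) (D k))
    (U : SimpleGraph V → Set (SiteConfig V)) (p : unitInterval) {t : ℝ}
    (ht : t ∈ Set.Icc (0 : ℝ) 1) :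
    HasDerivWithinAt
      (fun b : ℝ => ∫ τ, (sitePercolation V p).real (U (Γ τ))
        ∂(prodBernoulli fun _ : κ => Set.projIcc 0 1 zero_le_one b))
      (∑ k ∈ K, ∫ τ, flipResponse (Γ (τ \ {k})) (A k) (B k) (C k) (D k) U p
        ∂(prodBernoulli fun _ : κ => Set.projIcc 0 1 zero_le_one t))
      (Set.Icc 0 1) t := by
  have hg : ∀ τ : Set κ, (sitePercolation V p).real (U (Γ τ)) =
      (sitePercolation V p).real (U (Γ (τ ∩ ↑K))) := fun τ ↦ by rw [← hΓ τ]
  refine (hasDerivWithinAt_integral_prodBernoulli_const K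
    (fun τ ↦ (sitePercolation V p).real (U (Γ τ))) hg ht).congr_deriv ?_
  refine Finset.sum_congr rfl fun k hk ↦ integral_congr_ae (Eventually.of_forall fun τ ↦ ?_)
  -- pointwise, the bracket is the flip response at face `k`
  show (sitePercolation V p).real (U (Γ (insert k τ))) -
      (sitePercolation V p).real (U (Γ (τ \ {k}))) =
    flipResponse (Γ (τ \ {k})) (A k) (B k) (C k) (D k) U p
  rw [flipResponse_def, hflip τ k hk, measureReal_def, measureReal_def]

end Summit.CriticalPhenomena.CardyFormulaZ2.Theorems

end
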